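/-
Copyright (c) 2026 the pub-hodgecm-mathlib formalisation cell (harness21).  Prover seat hodgecm-mathlib-LH4-p04 (g2), req620 Track A «(D-RAM) FOUR-FRAME» squad
(unit U3_Laws, (R-22) «κS-RECUT»: the EVALUATION LEMMAS of the Ω defs leaf `…DiagonalGlueSignDefs`; heir LEAD T18-50 (d1), pen∕dealer LH4-plan (g12) WORD #1 (4)(i),
SHAPE MEMO v1 Q1 OPTION A, REF5 (g22) R5-114∕115, REF1 (g36) m15 (2)).  2026-09-04.
-/
import Summits.HodgeConjecture.HodgeConjecture.Theorems.F0P3cDyRamDiagonalGlueSignDefs                -- DEFS LEAF (this seat): `IsGlueRep`, `glueSign`, `glueSignR`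
import Summits.HodgeConjecture.HodgeConjecture.Theorems.F0P3cDyRamDiagonalKappaSignDictionaryRecut   -- ★ p856880 (this seat): (R0)∕(R1)∕(R2) with a representative binder; brings ★ FILE 1 p856809, ★ p06 ω-conductor toolkit (`normSign_eq_of_near`, `normSign_mul_of_fixed`), ★ `normSign_one`
import HarnessLib

/-!
# Crux `H413`, line LH4 «(D-RAM) FOUR-FRAME» road — unit U3_Laws (iii), (R-22) «κS-RECUT»: EVALUATION OF THE GLUE SIGN `Ω` —
# independence of the representative, «covered ⇒ `Ω = 1`», `Ω(b∕a)·Ω(b) = Ω(a)`, the three dictionary heads in `Ω`-currency, and `ampl q k B = 0` for `B ≤ 0`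

Cell `hodgecm-mathlib` (D-0151), FLOOR 0, crux item H413 = `stmt-HodgeConjecture-24833`, route of record `HCCMUnconditional`; squad F0∕P3c∕LH4 (req618∕req620); registered stubs
concerned: the Ω-aware re-letter of the κS leaves of `Cruxes/H413/Lines/F0_P3c_DyRamFourFrame_U3_Laws.lean` (SHAPE MEMO v1 §2: (κS-B₀²)∕(κS-B₂²)∕KSS²∕K-SGN-R2).
THEOREMS ONLY (no `def`, no instance, no notation, no `sorry`, default heartbeats); lane `--supports stmt-HodgeConjecture-24833 --as helper` (count-neutral).

THE MATHEMATICS.  `Ω(w) = glueSign σ ϖ d w` (DEFS LEAF, OPTION A with junk `1`) is `−1` iff `w` has a σ-fixed unit representative `u` modulo `U_E^{(2d−1)}` (`IsGlueRep`) which is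
not a norm.  §1 INDEPENDENCE: two representatives `u, u'` have `|u − u'| ≤ |ϖ|^{2d−1}`, so `ω(u) = ω(u')` (★ `normSign_eq_of_near`: `u∕u' ∈ F ∩ U_E^{(2d−1)} = U_F^{(d)} ⊆ N`,
the conductor of `E∕F` being `𝔭_F^d`) — hence `Ω(w) = ω(u)` for ANY representative, `Ω(w) = 1` when `w` is itself within `U_E^{(2d−1)}` of `1` (`u := 1`; every place of record,
REF5 R5-114∕115 «`d` odd ∨ `2d ≤ t + 2`»), and `Ω(b∕a)·Ω(b) = Ω(a)` when `a, b` have representatives (`u_b∕u_a` represents `b∕a`; ω multiplicative on fixed elements) — LH4-p05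
(g3)'s tokens `(b, b²∕a, b∕a)` ≡ REF5's symmetric `(b, a, b∕a)`.  §2 THE DICTIONARY IN Ω-CURRENCY: ★ Recut (R2)(R0)(R1) with the representative supplied by `IsGlueRep`:
`ω(f₀) = Ω(b∕a)·ω(−1)ω(fPartProd₂)`, `ω(1+f₀) = Ω(b)·ω(fPartProd₀)`, `ω(f₀(1+f₀)) = Ω(a)·ω(fPartProd₁)` — i.e. glue token_i = `glueSignR σ ϖ d a b i`-twisted law token, slot by
slot, under «a representative exists» (⟺ the axis is alive: `n_i ≥ 3d − 2`, REF5 R5-115 (2)).  §3 WHERE NO REPRESENTATIVE EXISTS the law's amplitude vanishes: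
`ampl q k B = 4·max 0 (q^k − q^{k−B})∕(q−1) = 0` for `B ≤ 0`, `q ≥ 1` (REF1 m15 (2)) — so the junk value of `Ω` is never read.
HONEST LABEL.  Count-neutral (`--supports`); nothing printed is asserted; the κS laws stay PROVER TARGETS under (R-22) review; `HC_CM` is proved only modulo the 7 printed citations
(2 remaining named inputs: hLiu418 = `stmt-HodgeConjecture-24832`, h413 = `stmt-HodgeConjecture-24833`) until rung 0 closes.

## References
* [Serre1979] J.-P. Serre, *Local Fields*, GTM 67 (1979), Ch. V §3 Prop. 5, Cor. 3 (the conductor of a ramified quadratic extension), Ch. XV §2.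
* [Rogawski1990] J. D. Rogawski, *Automorphic Representations of Unitary Groups in Three Variables*, Ann. of Math. Stud. 123 (1990), §4.9 Prop. 4.9.1 (a) p. 55, §4.10 p. 58.
* [LanglandsShelstad1987] R. P. Langlands, D. Shelstad, *On the definition of transfer factors*, Math. Ann. 278 (1987), §3.
-/

set_option autoImplicit false

noncomputable section

namespace Summit.HodgeConjecture.HodgeConjecture.Cruxes.H413.F0P3cDyRamDiagonalGlueSignEval

open Literature.NumberTheory.Automorphic Literature.NumberTheory.Automorphic.UnitaryThreeFourFrame
open Literature.NumberTheory.LocalFields Literature.NumberTheory.LocalFields.WildQuadraticDatum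
open Summit.HodgeConjecture.HodgeConjecture.Cruxes.H413.F0P3cDyRamDiagonalGlueSignDefs
open Summit.HodgeConjecture.HodgeConjecture.Cruxes.H413.F0P3cDyRamStableSumSignClasses (normSign_eq_one_or)
open Summit.HodgeConjecture.HodgeConjecture.Cruxes.H413.F0P3cDyRamFixedCountDiagonalModel (normSign_mul_norm)
open Summit.HodgeConjecture.HodgeConjecture.Cruxes.H413.F0P3cDyRamDiagonalKappaSignDictionary
open Summit.HodgeConjecture.HodgeConjecture.Cruxes.H413.F0P3cDyRamDiagonalKappaSignDictionaryRecut
open scoped Valued WithZero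

variable {K : Type} [Field K] [Valued K ℤᵐ⁰]

/-! ## §1  Independence of the representative; «covered ⇒ Ω = 1»; multiplicativity across the symmetric units -/

/-- **INDEPENDENCE OF THE REPRESENTATIVE: `Ω(w) = ω(u)` for EVERY σ-fixed unit representative `u` of `w` modulo `U_E^{(2d−1)}`** (two representatives are `|ϖ|^{2d−1}`-close fixed
units, hence have the same `ω`: ★ `normSign_eq_of_near`, Serre V §3 Cor. 3). [cite: Serre1979, Ch. V §3 Prop. 5, Cor. 3; Ch. XV §2] -/
theorem glueSign_eq_normSign [CompleteSpace K] {σ : K →+* K} {ϖ : K} {d t : ℕ} (hD : IsRamifiedQuadraticDatum σ ϖ d t)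
    {w u : K} (hu : IsGlueRep σ ϖ d w u) : glueSign σ ϖ d w = normSign σ u := by
  obtain ⟨hσu, hu1, hwu⟩ := hu
  -- any other representative has the same sign
  have hsame : ∀ u' : K, IsGlueRep σ ϖ d w u' → normSign σ u' = normSign σ u := by
    rintro u' ⟨hσu', -, hwu'⟩
    refine normSign_eq_of_near hD hσu hσu' hu1 (n := 2 * d - 1) le_rfl ?_
    have e : u - u' = (w - u') - (w - u) := by ring
    rw [e]
    exact (Valuation.map_sub _ _ _).trans (max_le hwu' hwu)
  rw [glueSign_eq]
  split_ifs with h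
  · obtain ⟨u', hu', hn'⟩ := h
    rw [← hsame u' hu', normSign_of_not_isNorm σ hn']
  · by_contra hne
    rcases normSign_eq_one_or σ u with h1 | h1
    · exact hne h1.symm
    · refine h ⟨u, ⟨hσu, hu1, hwu⟩, fun hex => ?_⟩
      rw [normSign_of_isNorm σ hex] at h1
      exact absurd h1 (by decide)

/-- **COVERED ⟹ `Ω = 1`**: if `w` is itself within `U_E^{(2d−1)}` of `1` then `u := 1` is a representative and `Ω(w) = ω(1) = 1`.  At a square datum with root guard
`|a − 1|, |b − 1| < |2|` this is the case for `w ∈ {b, a, b∕a}` whenever `2d ≤ t + 2` (`|w − 1| ≤ |ϖ|^{t+1}`), and at odd `d` whenever a representative exists at all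
(REF5 R5-114∕115) — every place of record. [cite: Serre1979, Ch. V §3 Prop. 5, Cor. 3] -/
theorem glueSign_eq_one_of_v_sub_one_le [CompleteSpace K] {σ : K →+* K} {ϖ : K} {d t : ℕ} (hD : IsRamifiedQuadraticDatum σ ϖ d t)
    {w : K} (hw : Valued.v (w - 1) ≤ Valued.v ϖ ^ (2 * d - 1)) : glueSign σ ϖ d w = 1 := by
  rw [glueSign_eq_normSign hD (u := 1) ⟨map_one σ, map_one _, hw⟩, normSign_one]

/-- **`u_b ∕ u_a` REPRESENTS `b ∕ a`** when `u_b` represents the unit `b` and `u_a` represents the unit `a`. [cite: Serre1979, Ch. V §3 Cor. 3] -/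
theorem isGlueRep_div {σ : K →+* K} {ϖ : K} {d : ℕ} {a b u_a u_b : K} (ha : Valued.v a = 1)
    (hra : IsGlueRep σ ϖ d a u_a) (hrb : IsGlueRep σ ϖ d b u_b) : IsGlueRep σ ϖ d (b / a) (u_b / u_a) := by
  obtain ⟨hσa, hua, hwa⟩ := hra
  obtain ⟨hσb, hub, hwb⟩ := hrb
  have ha0 : a ≠ 0 := fun h => by rw [h, map_zero] at ha; exact zero_ne_one ha
  have hua0 : u_a ≠ 0 := fun h => by rw [h, map_zero] at hua; exact zero_ne_one hua
  refine ⟨by rw [map_div₀, hσa, hσb], by rw [map_div₀, hua, hub, div_one], ?_⟩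
  have e : b / a - u_b / u_a = ((b - u_b) * u_a + u_b * (u_a - a)) / (a * u_a) := by field_simp; ring
  rw [e, map_div₀, map_mul, ha, hua, one_mul, div_one]
  refine (Valuation.map_add _ _ _).trans (max_le ?_ ?_)
  · rw [map_mul, hua, mul_one]; exact hwb
  · rw [map_mul, hub, one_mul, Valuation.map_sub_swap]; exact hwa

/-- **`Ω(b∕a)·Ω(b) = Ω(a)`** when `a` and `b` have representatives (ω multiplicative on fixed units): LH4-p05 (g3)'s slot-1 token `Ω(b²∕a) = Ω(b∕a)Ω(b)` IS the symmetric unit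
`Ω(a)` of REF5 R5-115 (2). [cite: Serre1979, Ch. V §3 Cor. 3; Ch. XV §2] -/
theorem glueSign_div_mul [CompleteSpace K] [Fintype 𝓀[K]] {σ : K →+* K} {ϖ : K} {d t : ℕ} (hD : IsRamifiedQuadraticDatum σ ϖ d t)
    {a b u_a u_b : K} (ha : Valued.v a = 1) (hra : IsGlueRep σ ϖ d a u_a) (hrb : IsGlueRep σ ϖ d b u_b) :
    glueSign σ ϖ d (b / a) * glueSign σ ϖ d b = glueSign σ ϖ d a := by
  have hua0 : u_a ≠ 0 := fun h => by have := hra.2.1; rw [h, map_zero] at this; exact zero_ne_one this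
  have hub0 : u_b ≠ 0 := fun h => by have := hrb.2.1; rw [h, map_zero] at this; exact zero_ne_one this
  rw [glueSign_eq_normSign hD (isGlueRep_div ha hra hrb), glueSign_eq_normSign hD hra, glueSign_eq_normSign hD hrb, div_eq_mul_inv,
    normSign_mul_of_fixed hD hrb.1 (by rw [map_inv₀, hra.1]) hub0 (inv_ne_zero hua0),
    show u_a⁻¹ = u_a * (u_a⁻¹ * σ u_a⁻¹) from by rw [map_inv₀, hra.1]; field_simp, normSign_mul_norm σ u_a (inv_ne_zero hua0)]
  rcases normSign_eq_one_or σ u_b with h | h <;> rw [h] <;> ring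

/-! ## §2  The three dictionary heads in `Ω`-currency (★ Recut (R2)(R0)(R1) + `glueSign_eq_normSign`) -/

/-- **SLOT 2 ∕ THE GLUE WITNESS: `ω(f₀) = Ω(b∕a)·ω(−1)·ω(fPartProd δ (a,b,1) 2)`** whenever `b∕a` has a representative (the alive axis) and `|f₀ + g| ≤ |ϖ|^{2d−1}·|g|`
(`g = (b²−1)∕(a²−1)`). [cite: Rogawski1990, §4.10 p. 58] [cite: Serre1979, Ch. V §3 Prop. 5, Cor. 3] -/
theorem normSign_glueWitness_eq_glueSign [CompleteSpace K] [Fintype 𝓀[K]] {σ : K →+* K} {ϖ : K} {d t : ℕ} (hD : IsRamifiedQuadraticDatum σ ϖ d t)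
    {δ a b : K} (hδ : σ δ = -δ) (hδ0 : δ ≠ 0) (ha : a * σ a = 1) (hb : b * σ b = 1) (hα1 : a * a ≠ 1) (hβ1 : b * b ≠ 1)
    {f₀ : K} (hσf₀ : σ f₀ = f₀) (hf00 : f₀ ≠ 0) (hrep : ∃ u : K, IsGlueRep σ ϖ d (b / a) u)
    (hf₀ : Valued.v (f₀ + (b * b - 1) / (a * a - 1)) ≤ Valued.v ϖ ^ (2 * d - 1) * Valued.v ((b * b - 1) / (a * a - 1))) :
    normSign σ f₀ = glueSign σ ϖ d (b / a) * (normSign σ (-1) * normSign σ (fPartProd δ ![a, b, 1] 2)) := by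
  obtain ⟨u, hu⟩ := hrep
  rw [glueSign_eq_normSign hD hu]
  exact normSign_glueWitness_eq_mul hD hδ hδ0 ha hb hα1 hβ1 hσf₀ hf00 le_rfl hu.1 hu.2.1 hu.2.2 hf₀

/-- **SLOT 0 ∕ THE APEX: `ω(1 + f₀) = Ω(b)·ω(fPartProd δ (a,b,1) 0)`** whenever `b` has a representative and `|f₀ + g| ≤ |ϖ|^{2d−1}·|1 − g|`.
[cite: Rogawski1990, §4.10 p. 58] [cite: Serre1979, Ch. V §3 Prop. 5, Cor. 3] -/
theorem normSign_one_add_glueWitness_eq_glueSign [CompleteSpace K] [Fintype 𝓀[K]] {σ : K →+* K} {ϖ : K} {d t : ℕ} (hD : IsRamifiedQuadraticDatum σ ϖ d t)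
    {δ a b : K} (hδ : σ δ = -δ) (hδ0 : δ ≠ 0) (ha : a * σ a = 1) (hb : b * σ b = 1) (hα1 : a * a ≠ 1) (hαβ : a * a ≠ b * b)
    {f₀ : K} (hσf₀ : σ f₀ = f₀) (hf1 : 1 + f₀ ≠ 0) (hrep : ∃ u : K, IsGlueRep σ ϖ d b u)
    (hf₀ : Valued.v (f₀ + (b * b - 1) / (a * a - 1)) ≤ Valued.v ϖ ^ (2 * d - 1) * Valued.v (1 - (b * b - 1) / (a * a - 1))) :
    normSign σ (1 + f₀) = glueSign σ ϖ d b * normSign σ (fPartProd δ ![a, b, 1] 0) := by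
  obtain ⟨u, hu⟩ := hrep
  rw [glueSign_eq_normSign hD hu]
  exact normSign_one_add_glueWitness_eq_mul hD hδ hδ0 ha hb hα1 hαβ hσf₀ hf1 le_rfl hu.1 hu.2.1 hu.2.2 hf₀

/-- **SLOT 1 ∕ THE CROSS SLOT: `ω(f₀·(1 + f₀)) = Ω(a)·ω(fPartProd δ (a,b,1) 1)`** whenever `a` and `b` have representatives and both relative glue depths hold
(`Ω(b∕a)·Ω(b) = Ω(a)`, `glueSign_div_mul`). [cite: Rogawski1990, §4.10 p. 58] [cite: Serre1979, Ch. V §3 Prop. 5, Cor. 3] -/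
theorem normSign_glueWitness_mul_one_add_eq_glueSign [CompleteSpace K] [Fintype 𝓀[K]] {σ : K →+* K} {ϖ : K} {d t : ℕ} (hD : IsRamifiedQuadraticDatum σ ϖ d t)
    {δ a b : K} (hδ : σ δ = -δ) (hδ0 : δ ≠ 0) (ha : a * σ a = 1) (hb : b * σ b = 1) (hα1 : a * a ≠ 1) (hβ1 : b * b ≠ 1) (hαβ : a * a ≠ b * b)
    {f₀ : K} (hσf₀ : σ f₀ = f₀) (hf0 : f₀ ≠ 0) (hf1 : 1 + f₀ ≠ 0) (hrepa : ∃ u : K, IsGlueRep σ ϖ d a u) (hrepb : ∃ u : K, IsGlueRep σ ϖ d b u)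
    (hf₀ : Valued.v (f₀ + (b * b - 1) / (a * a - 1)) ≤ Valued.v ϖ ^ (2 * d - 1) * Valued.v ((b * b - 1) / (a * a - 1)))
    (hf₀' : Valued.v (f₀ + (b * b - 1) / (a * a - 1)) ≤ Valued.v ϖ ^ (2 * d - 1) * Valued.v (1 - (b * b - 1) / (a * a - 1))) :
    normSign σ (f₀ * (1 + f₀)) = glueSign σ ϖ d a * normSign σ (fPartProd δ ![a, b, 1] 1) := by
  obtain ⟨u_a, hra⟩ := hrepa
  obtain ⟨u_b, hrb⟩ := hrepb
  have hva : Valued.v a = 1 := v_eq_one_of_mul_map_eq_one hD.2.1 ha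
  have hrq := isGlueRep_div hva hra hrb
  rw [← glueSign_div_mul hD hva hra hrb, glueSign_eq_normSign hD hrq, glueSign_eq_normSign hD hrb]
  exact normSign_glueWitness_mul_one_add_eq_mul hD hδ hδ0 ha hb hα1 hβ1 hαβ hσf₀ hf0 hf1 le_rfl hrq.1 hrq.2.1 hrq.2.2 hrb.1 hrb.2.1 hrb.2.2 hf₀ hf₀'

/-! ## §3  The amplitude vanishes where `Ω` would be junk -/

/-- **`ampl q k B = 0` for `B ≤ 0`** (`q ≥ 1`): `q^k − q^{k−B} ≤ 0`, so the `max 0` clips it (★ #0a H11 «`B ≤ 0 ⇒ 0`»; REF1 (g36) m15 (2): the junk value of `Ω` on an axis without a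
representative is multiplied by this `0`). [cite: Rogawski1990, §4.9 Prop. 4.9.1 (a) p. 55] -/
theorem ampl_eq_zero_of_nonpos {q : ℕ} (hq : 1 ≤ q) (k : ℕ) {B : ℤ} (hB : B ≤ 0) : ampl q k B = 0 := by
  unfold ampl
  have hq' : (1 : ℚ) ≤ q := by exact_mod_cast hq
  have hle : (q : ℚ) ^ (k : ℤ) ≤ (q : ℚ) ^ ((k : ℤ) - B) := zpow_le_zpow_right₀ hq' (by omega)
  rw [max_eq_left (sub_nonpos.2 hle), mul_zero, zero_div]

end Summit.HodgeConjecture.HodgeConjecture.Cruxes.H413.F0P3cDyRamDiagonalGlueSignEval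

end
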